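import Summits.BirchSwinnertonDyer.BirchSwinnertonDyer.Theorems.SlopeDichotomyA2DegenerateLocusA2HeightIntegrality
import Summits.BirchSwinnertonDyer.BirchSwinnertonDyer.Theorems.SlopeDichotomyA2DegenerateLocusA2RegulatorFloorSharp
import Literature.NumberTheory.EllipticCurves.PadicSigmaOddPrime
import Literature.NumberTheory.EllipticCurves.IsogenyMordellWeilRankProofs
import Literature.NumberTheory.EllipticCurves.BSDQuadraticDescentCasselsProofs
import HarnessLib
import Literature.NumberTheory.EllipticCurves.CanonicalPAdicHeightIsogenyAdjoint

/-!
# H-int along a degree-`p` isogeny (modulo Mazur–Tate's adjunction) and its corner-A2 consequences: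
# the regulator floor `0 ≤ ord_p Reg_p` and T-λ3 (`λ_an ≥ 3`) on the isogeny-descent locus

Support file (prover seat `bsd-schneider-i1-c2`, gen 6, cell `bsd-schneider-ideate`; `--supports
stmt-BirchSwinnertonDyer-19086`), companion of `SlopeDichotomyA2DegenerateLocusA2HeightIntegrality.lean` (the
abstract Lemma H-int: an additive `f : E(ℚ) → E'(ℚ)` with (red), (comp), (adj) makes THE canonical `p`-adic height
of `E` `p`-integral). Here (adj) is DISCHARGED for the map on rational points of a degree-`p` `ℚ`-isogeny from ONE
published fact stated inline (§0, cite-tagged for relocation under `Literature/NumberTheory/EllipticCurves/`), and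
the result is fed into the regulator-floor series (`…RegulatorFloor` p448248 / `…FloorPub` p448618 / `…FloorSharp`
p449700): on corner A2 it discharges the floor binder `hRT` of
`DegenerateLocusA2RegulatorFloorPub.not_analyticLambdaEq_one_of_typeBRankOne_of_regTamFloor`, so T-λ3 («`λ_an ≠ 1`,
hence `λ_an ≥ 3`», memo ROUTE-P3-v8 (T1)) holds at every A2 pair `(W, p)` with `p ∤` the local indices of `W` that
admits a degree-`p` isogeny with (red) and (comp) — from published inputs BY NAME (W16, BMS 1.7, GV 1.3, Greenberg
5.10, Mazur–Tate σ, modularity, GZK, MT83 (3.4.3)) plus that per-pair structure; NO height value is inspected.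

* §0 `canonicalPAdicHeight_isogeny_adjoint` — NAMED FACT (nothing asserted): Mazur–Tate 1983 (3.4.3) «change of
  abelian variety» for THE canonical cyclotomic `p`-adic height pairings of `ℚ`-isogenous elliptic curves — an
  isogeny and its dual are ADJOINT, `⟨φ P, Q'⟩_{E'} = ⟨P, φ̂ Q'⟩_E` (the `p`-adic twin of the tree THEOREM
  `WeierstrassCurve.Isogeny.heightPairing_pointHom_left` for the Néron–Tate pairing, Milne ADT I.7.3).
* §3 `exists_pointHom_rat`, `pointHom_comp_eq_nsmul_rat` (the `DecidableEq ℚ` bridge of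
  `WeierstrassCurve.bsdRHS_eq_of_keyIdentity`: the general-field isogeny API carries the classical instance),
  `pairing_pointHom_pointHom_of_adjoint` (`⟨fP, fQ⟩' = deg φ · ⟨P, Q⟩`), `valuation_padicRegulator_nonneg_of_isogeny`
  (H-int for a degree-`p` `ℚ`-isogeny with (red), (comp): `‖⟨P,Q⟩‖ ≤ 1` and `0 ≤ ord_p Reg_p`).
* §4 corner A2: `regTamFloor_of_typeBRankOne_of_isogeny`, **`not_analyticLambdaEq_one_of_typeBRankOne_of_isogeny`**,
  `three_le_of_analyticLambdaEq_of_typeBRankOne_of_isogeny`.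

HONEST NOTE. (red) `p • R ∈ E₁(ℚ_p) ⇒ f R ∈ E'₁(ℚ_p)` and (comp) `f(E(ℚ) ∩ E⁰(ℚ_ℓ)) ⊆ E'⁰(ℚ_ℓ)` remain per-isogeny
STRUCTURAL hypotheses (Néron mapping property + «`ker φ` is the unramified line at the anomalous `p`», memo v8
§1.3 (b); kit j253553: 560/560) — the tree's `Isogeny` has no map on `ℚ_p`-points compatible with reduction. The
index hypothesis is on `W` (NOT on `W'`): by the census kit j257621 (all 2 797 A2 class-pairs, `W = E₁` the
listed member carrying the unramified line, `W' = E₁/Φ`) `p ∤ ∏c_ℓ(E₁)` on 1 765, `p ∤ ∏c_ℓ(E₁/Φ)` on 716, never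
both (the quotient acquires `p ∣ c_ℓ` at a multiplicative prime exactly when `E₁` has none) — (comp) makes the
Tamagawa numbers of `W'` irrelevant. Item 19086 is untouched (DECIDED-REDUCED, gens 0–5); BSD is not advanced;
every theorem here is conditional on named facts.

References: Mazur–Tate, *Canonical height pairings via biextensions*, Progr. Math. 35 (1983), §3.4 (3.4.3)
[MazurTate1983Biext]; Mazur–Stein–Tate, Doc. Math. Extra Vol. (2006), §1 fn. 1, §2.6–2.8 [MazurSteinTate2006];
Silverman, AEC (2009) III.6.1–6.2 [SilvermanAEC2009]; memo ROUTE-P3-v8-lambda-g10 §1.2–1.3; FINDING-i1-c2-g5 §3.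
-/

set_option autoImplicit false

noncomputable section

open scoped Classical MatrixGroups ModularForm

open PowerSeries CongruenceSubgroup WeierstrassCurve Literature.NumberTheory.EllipticCurves
  Literature.NumberTheory.EllipticCurves.ModularForms Literature.NumberTheory.EllipticCurves.Rank1Residual
  Literature.NumberTheory.EllipticCurves.Greenberg1999 Summit.BirchSwinnertonDyer.Rank1Residual
  Summit.BirchSwinnertonDyer.BirchSwinnertonDyer.Theorems.Rank1ResidualX1Defs
  Summit.BirchSwinnertonDyer.Rank1Residual.X1.MuLambda Summit.BirchSwinnertonDyer.Rank1Residual.X1.MuPart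
  Summit.BirchSwinnertonDyer.Rank1Residual.X1.ParitySqueeze Summit.BirchSwinnertonDyer.BirchSwinnertonDyer.Theses
  Summit.BirchSwinnertonDyer.BirchSwinnertonDyer.Theorems
  Summit.BirchSwinnertonDyer.BirchSwinnertonDyer.Theorems.DegenerateLocusA2HeightIntegrality

set_option linter.dupNamespace false -- summit = sub-problem name (D-0017 layout)

namespace Summit.BirchSwinnertonDyer.BirchSwinnertonDyer.Theorems.DegenerateLocusA2HeightIntegralityIsogeny

/-! ## §0. The named fact: Mazur–Tate's functoriality of THE canonical `p`-adic height under isogeny -/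

variable {W W' : WeierstrassCurve ℚ} [W.IsGloballyMinimal] [W'.IsGloballyMinimal] {p : ℕ} [Fact p.Prime]

/-! ## §3. With the Mazur–Tate fact: H-int for a degree-`p` isogeny -/

omit [W.IsGloballyMinimal] [W'.IsGloballyMinimal] [Fact p.Prime] in
/-- `Isogeny.exists_pointHom` over `ℚ`, polymorphic in the `DecidableEq ℚ` instance of the group law on
`E(ℚ)` (the general-field theorem carries the classical instance; a subsingleton bridge, as in
`WeierstrassCurve.bsdRHS_eq_of_keyIdentity`). [cite: SilvermanAEC2009, III.4 and VIII.§1] -/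
theorem exists_pointHom_rat [DecidableEq ℚ] (φ : Isogeny W W') :
    ∃ f : W.toAffine.Point →+ W'.toAffine.Point, ∀ P : W.toAffine.Point,
      W'.toGeomPoints (f P) = φ (W.toGeomPoints P) := by
  obtain rfl : ‹DecidableEq ℚ› = fun a b ↦ Classical.propDecidable (a = b) := Subsingleton.elim _ _
  exact φ.exists_pointHom

omit [W.IsGloballyMinimal] [W'.IsGloballyMinimal] [Fact p.Prime] in
/-- `g ∘ f = [m]` on `E(ℚ)` for the maps on rational points of an isogeny `φ` and of an isogeny `ψ` with
`ψ ∘ φ = [m]` (Silverman AEC III.6.2(a)), polymorphic in the `DecidableEq ℚ` instance (same bridge; the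
general-field version is `WeierstrassCurve.Isogeny.pointHom_comp_eq_nsmul`). [cite: SilvermanAEC2009, III.6.2] -/
theorem pointHom_comp_eq_nsmul_rat [DecidableEq ℚ] (φ : Isogeny W W') (ψ : Isogeny W' W) {m : ℕ}
    (hψφ : ∀ P : W.geomPoints, ψ (φ P) = (m : ℤ) • P)
    {f : W.toAffine.Point →+ W'.toAffine.Point}
    (hf : ∀ P : W.toAffine.Point, W'.toGeomPoints (f P) = φ (W.toGeomPoints P))
    {g : W'.toAffine.Point →+ W.toAffine.Point}
    (hg : ∀ Q : W'.toAffine.Point, W.toGeomPoints (g Q) = ψ (W'.toGeomPoints Q))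
    (P : W.toAffine.Point) : g (f P) = m • P := by
  obtain rfl : ‹DecidableEq ℚ› = fun a b ↦ Classical.propDecidable (a = b) := Subsingleton.elim _ _
  exact Isogeny.pointHom_comp_eq_nsmul φ ψ hψφ hf hg P

/-- **`⟨f P, f Q⟩' = deg φ · ⟨P, Q⟩` for THE canonical `p`-adic heights along a `ℚ`-isogeny** (from the
adjunction fact §0 and the dual isogeny: `⟨fP, fQ⟩' = ⟨P, g(fQ)⟩ = ⟨P, deg φ • Q⟩`; the tree's
`heightPairing_pointHom_pointHom` is the Néron–Tate twin). [cite: MazurTate1983Biext, §3.4 (3.4.3)]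
[cite: SilvermanAEC2009, III.6.1–6.2] -/
theorem pairing_pointHom_pointHom_of_adjoint [W.IsElliptic] [W'.IsElliptic]
    (hadjF : Literature.NumberTheory.EllipticCurves.canonicalPAdicHeight_isogeny_adjoint)
    (hp2 : p ≠ 2) (hgood : W.HasGoodReductionAtPrime p) (hord : ¬ (p : ℤ) ∣ W.frobeniusTrace p)
    (hgood' : W'.HasGoodReductionAtPrime p) (hord' : ¬ (p : ℤ) ∣ W'.frobeniusTrace p)
    (φ : Isogeny W W') {f : W.toAffine.Point →+ W'.toAffine.Point}
    (hf : ∀ P : W.toAffine.Point, W'.toGeomPoints (f P) = φ (W.toGeomPoints P))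
    {D : PAdicHeightData W p} {D' : PAdicHeightData W' p} (hD : D.IsCanonical) (hD' : D'.IsCanonical)
    (P Q : W.toAffine.Point) :
    D'.pairing (f P) (f Q) = (φ.degree : ℚ_[p]) * D.pairing P Q := by
  obtain ⟨ψ, hψ⟩ := φ.exists_dual_of_isElliptic
  obtain ⟨g, hg⟩ := exists_pointHom_rat ψ
  rw [hadjF W W' p hp2 hgood hord hgood' hord' φ ψ hψ f hf g hg D D' hD hD' P (f Q),
    pointHom_comp_eq_nsmul_rat φ ψ hψ hf hg Q, map_nsmul, nsmul_eq_mul]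

/-- **H-int (memo ROUTE-P3-v8 §1.3) for a degree-`p` isogeny: THE canonical height of `E` is `p`-integral and
`0 ≤ ord_p Reg_p`** — for globally minimal elliptic `E, E'/ℚ`, an odd prime `p ≥ 3` good ordinary for both with
`ord_p #Ẽ(𝔽_p) ≤ 1`, `p ∤` the local indices `[E(ℚ) : E(ℚ) ∩ E⁰(ℚ_ℓ)]`, and a degree-`p` `ℚ`-isogeny
`φ : E → E'` whose map on rational points satisfies (red) and (comp). Modulo the named facts MT83 (3.4.3)
(`hadjF`) and Mazur–Tate σ at odd `p` (`hMT`, for THE canonical datum of `E'`).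
[cite: MazurTate1983Biext, §3.4 (3.4.3)] [cite: MazurSteinTate2006, §1 eq. (1.1), Thm. 1.3] -/
theorem valuation_padicRegulator_nonneg_of_isogeny [W.IsElliptic] [W'.IsElliptic]
    (hadjF : Literature.NumberTheory.EllipticCurves.canonicalPAdicHeight_isogeny_adjoint)
    (hMT : mazur_tate_sigma_exists_odd) (hp : 3 ≤ p)
    (hgood : W.HasGoodReductionAtPrime p) (hord : ¬ (p : ℤ) ∣ W.frobeniusTrace p)
    (hgood' : W'.HasGoodReductionAtPrime p) (hord' : ¬ (p : ℤ) ∣ W'.frobeniusTrace p)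
    (hN : padicValNat p (W.reductionPointCount p) ≤ 1)
    (hidx : ∀ (ℓ : ℕ) [Fact ℓ.Prime], ¬ p ∣ (W.nonsingularReductionSubgroupAt ℓ).index)
    (φ : Isogeny W W') (hdeg : φ.degree = p) {f : W.toAffine.Point →+ W'.toAffine.Point}
    (hf : ∀ P : W.toAffine.Point, W'.toGeomPoints (f P) = φ (W.toGeomPoints P))
    (hred : ∀ R : W.toAffine.Point, p • R ∈ W.kernelOfReductionAt p → f R ∈ W'.kernelOfReductionAt p)
    (hcomp : ∀ (ℓ : ℕ) [Fact ℓ.Prime], ∀ R ∈ W.nonsingularReductionSubgroupAt ℓ,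
      f R ∈ W'.nonsingularReductionSubgroupAt ℓ)
    {D : PAdicHeightData W p} (hD : D.IsCanonical) :
    (∀ P Q : W.toAffine.Point, ‖D.pairing P Q‖ ≤ 1) ∧
      (padicRegulator D ≠ 0 → 0 ≤ (padicRegulator D).valuation) := by
  have hp2 : p ≠ 2 := by omega
  obtain ⟨D', hD'⟩ := exists_isCanonical_of_odd hMT W' p hp2 hgood' hord'
  have hadj : ∀ P Q : W.toAffine.Point, D'.pairing (f P) (f Q) = (p : ℚ_[p]) * D.pairing P Q := by
    intro P Q
    rw [pairing_pointHom_pointHom_of_adjoint hadjF hp2 hgood hord hgood' hord' φ hf hD hD', hdeg]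
  exact ⟨norm_pairing_le_one_of_isogenyDescent hp hgood hN hidx f hred hcomp hD' hadj,
    valuation_padicRegulator_nonneg_of_isogenyDescent hp hgood hN hidx f hred hcomp hD' hadj⟩

/-! ## §4. Corner A2: the regulator–Tamagawa floor and T-λ3 on the isogeny-descent locus -/

/-- **On corner A2, H-int discharges the floor binder `hRT` of the regulator-floor series**: for an A2 pair
`(W, p)` (`X1.TypeBRankOne`: good ordinary anomalous odd `p`, GV parity, `r_an = 1`) with `p ∤` the local
indices `[W(ℚ) : W(ℚ) ∩ W⁰(ℚ_ℓ)]` and a degree-`p` `ℚ`-isogeny `φ : W → W'` onto a globally minimal `W'` whose map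
on rational points satisfies (red) and (comp), EVERY canonical datum has `Reg_p ≠ 0 → 0 ≤ ord_p Reg_p + ord_p ∏c_ℓ`
(indeed `0 ≤ ord_p Reg_p`).
`ord_p #Ẽ(𝔽_p) = 1` on the leaf (`RankOne.Leaf.padicValNat_reductionPointCount_eq_one`); `W'` is again a
leaf curve (`RankOne.Leaf.of_isIsogenous`: good ordinary reduction at `p` is isogeny-invariant).
[cite: MazurTate1983Biext, §3.4 (3.4.3)] [cite: MazurSteinTate2006, Thm. 1.3] -/
theorem regTamFloor_of_typeBRankOne_of_isogeny [W.IsElliptic] [W'.IsElliptic]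
    (hadjF : Literature.NumberTheory.EllipticCurves.canonicalPAdicHeight_isogeny_adjoint) (hMT : mazur_tate_sigma_exists_odd)
    (hB : X1.TypeBRankOne W p)
    (hidx : ∀ (ℓ : ℕ) [Fact ℓ.Prime], ¬ p ∣ (W.nonsingularReductionSubgroupAt ℓ).index)
    (φ : Isogeny W W') (hdeg : φ.degree = p) {f : W.toAffine.Point →+ W'.toAffine.Point}
    (hf : ∀ P : W.toAffine.Point, W'.toGeomPoints (f P) = φ (W.toGeomPoints P))
    (hred : ∀ R : W.toAffine.Point, p • R ∈ W.kernelOfReductionAt p → f R ∈ W'.kernelOfReductionAt p)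
    (hcomp : ∀ (ℓ : ℕ) [Fact ℓ.Prime], ∀ R ∈ W.nonsingularReductionSubgroupAt ℓ,
      f R ∈ W'.nonsingularReductionSubgroupAt ℓ) :
    ∀ Dh : PAdicHeightData W p, Dh.IsCanonical → padicRegulator Dh ≠ 0 →
      0 ≤ (padicRegulator Dh).valuation + (padicValNat p W.tamagawaProduct : ℤ) := by
  intro Dh hDh hR
  have hX := isClassX1_of_classX1 hB.1
  have hL : X1.RankOne.Leaf W p := X1.RankOne.leaf_of_classX1 hB.1 hB.2.1
  -- the isogenous member is again a leaf curve: good ordinary (anomalous) reduction at `p`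
  have hX' := isClassX1_of_classX1 (hL.of_isIsogenous ⟨φ⟩).1
  have hp3 : 3 ≤ p := by
    have h2 := hB.1.1
    have hp2 := hX.two_ne
    omega
  have hN : padicValNat p (W.reductionPointCount p) ≤ 1 := hL.padicValNat_reductionPointCount_eq_one.le
  have h := (valuation_padicRegulator_nonneg_of_isogeny hadjF hMT hp3 hX.hasGoodReductionAtPrime
    hX.not_dvd_frobeniusTrace hX'.hasGoodReductionAtPrime hX'.not_dvd_frobeniusTrace hN hidx φ hdeg hf
    hred hcomp hDh).2 hR
  have hT : (0 : ℤ) ≤ padicValNat p W.tamagawaProduct := by exact_mod_cast Nat.zero_le _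
  linarith

/-- **T-λ3 on the isogeny-descent locus of corner A2 (memo ROUTE-P3-v8 (T1), published inputs + per-pair
structure, NO height value inspected): `λ_an ≠ 1`.** At an A2 pair `(W, p)` with `p ∤` the local indices of
`W` (e.g. `p ∤ ∏c_ℓ(W)`: 1 765 of the 2 797 A2 class-pairs, kit j257621) and a degree-`p` `ℚ`-isogeny
`φ : W → W'` onto a globally minimal `W'` satisfying (red) and (comp): the unit-coefficient certificate
`AnalyticLambdaEq W p 1` is impossible. Inputs BY NAME: W16, Perrin-Riou–Schneider (BMS 1.7), GV
Thm. 1.3, Greenberg Prop. 5.10, Mazur–Tate σ (odd `p`), modularity, GZK, and MT83 (3.4.3).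
[cite: BalakrishnanMullerStein2015, Thm. 1.7] [cite: GreenbergVatsal2000, Thm. (1.3)]
[cite: GreenbergLNM1716, Prop. 5.10 (PDF p. 147)] [cite: Wuthrich2014, Thm. 16 (p. 393)]
[cite: MazurTate1983Biext, §3.4 (3.4.3)] -/
theorem not_analyticLambdaEq_one_of_typeBRankOne_of_isogeny [W.IsElliptic] [W'.IsElliptic]
    (hW16 : Wuthrich2014.charIdeal_dvd_padicLFunction) (hS : Schneider1985_order_charGenerator_odd)
    (hGV : GreenbergVatsal2000.thm13_charIdeal_eq_of_gvPar)
    (h510 : prop510_isTorsion_hasUnitContent_of_gvPar) (hMT : mazur_tate_sigma_exists_odd)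
    (hmodP : nonempty_modularParametrizationData) (hGZK : rank_eq_analyticRank_of_analyticRank_le_one)
    (hadjF : Literature.NumberTheory.EllipticCurves.canonicalPAdicHeight_isogeny_adjoint) (hB : X1.TypeBRankOne W p)
    (hidx : ∀ (ℓ : ℕ) [Fact ℓ.Prime], ¬ p ∣ (W.nonsingularReductionSubgroupAt ℓ).index)
    (φ : Isogeny W W') (hdeg : φ.degree = p) {f : W.toAffine.Point →+ W'.toAffine.Point}
    (hf : ∀ P : W.toAffine.Point, W'.toGeomPoints (f P) = φ (W.toGeomPoints P))
    (hred : ∀ R : W.toAffine.Point, p • R ∈ W.kernelOfReductionAt p → f R ∈ W'.kernelOfReductionAt p)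
    (hcomp : ∀ (ℓ : ℕ) [Fact ℓ.Prime], ∀ R ∈ W.nonsingularReductionSubgroupAt ℓ,
      f R ∈ W'.nonsingularReductionSubgroupAt ℓ) :
    ¬ AnalyticLambdaEq W p 1 :=
  DegenerateLocusA2RegulatorFloorPub.not_analyticLambdaEq_one_of_typeBRankOne_of_regTamFloor hW16 hS hGV
    h510 hMT hmodP hGZK hB
    (regTamFloor_of_typeBRankOne_of_isogeny hadjF hMT hB hidx φ hdeg hf hred hcomp)

/-- **T-λ3, counted form: on the isogeny-descent locus of corner A2 every certified `λ_an = n` has `n ≥ 3`**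
(λ-parity on rank one excludes `λ_an = 2`; `…RegulatorFloorPub.three_le_of_analyticLambdaEq_…`).
[cite: GreenbergVatsal2000, Thm. (1.3)] [cite: MazurTateTeitelbaum1986Invent, §I.17–I.18]
[cite: MazurTate1983Biext, §3.4 (3.4.3)] [cite: BalakrishnanMullerStein2015, Thm. 1.7] -/
theorem three_le_of_analyticLambdaEq_of_typeBRankOne_of_isogeny [W.IsElliptic] [W'.IsElliptic]
    (hW16 : Wuthrich2014.charIdeal_dvd_padicLFunction) (hS : Schneider1985_order_charGenerator_odd)
    (hGV : GreenbergVatsal2000.thm13_charIdeal_eq_of_gvPar)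
    (h510 : prop510_isTorsion_hasUnitContent_of_gvPar) (hMT : mazur_tate_sigma_exists_odd)
    (hmodP : nonempty_modularParametrizationData) (hGZK : rank_eq_analyticRank_of_analyticRank_le_one)
    (hadjF : Literature.NumberTheory.EllipticCurves.canonicalPAdicHeight_isogeny_adjoint) (hB : X1.TypeBRankOne W p)
    (hidx : ∀ (ℓ : ℕ) [Fact ℓ.Prime], ¬ p ∣ (W.nonsingularReductionSubgroupAt ℓ).index)
    (φ : Isogeny W W') (hdeg : φ.degree = p) {f : W.toAffine.Point →+ W'.toAffine.Point}
    (hf : ∀ P : W.toAffine.Point, W'.toGeomPoints (f P) = φ (W.toGeomPoints P))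
    (hred : ∀ R : W.toAffine.Point, p • R ∈ W.kernelOfReductionAt p → f R ∈ W'.kernelOfReductionAt p)
    (hcomp : ∀ (ℓ : ℕ) [Fact ℓ.Prime], ∀ R ∈ W.nonsingularReductionSubgroupAt ℓ,
      f R ∈ W'.nonsingularReductionSubgroupAt ℓ) {n : ℕ} (hn : AnalyticLambdaEq W p n) : 3 ≤ n :=
  DegenerateLocusA2RegulatorFloorPub.three_le_of_analyticLambdaEq_of_typeBRankOne_of_regTamFloor hW16 hS
    hGV h510 hMT hmodP hGZK hB
    (regTamFloor_of_typeBRankOne_of_isogeny hadjF hMT hB hidx φ hdeg hf hred hcomp) hn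

end Summit.BirchSwinnertonDyer.BirchSwinnertonDyer.Theorems.DegenerateLocusA2HeightIntegralityIsogeny

end
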